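import Mathlib

/-!
# Stub `stub_resolventUnique` of the line `Sketch` (crux stmt-AnomalousDissipation-3008), part A:
# integrability bootstrap for the Weber energy lemma

Registered stub (proved in `MarginalStabilityChainBurgersLayerKHStubResolventUnique.lean`, which imports
part B, which imports this file):
`theorem stub_resolventUnique : ∀ α : ℝ, 0 < α → α ≤ 1 → ∀ lam : ℂ, 0 < lam.re → ∀ h : ℝ, 0 < h →
ResolventUniqueAt α h lam` — uniqueness of the Gaussian-class resolvent of `λ + iU − h·OU`.

The engine is the WEBER ENERGY LEMMA: a bounded `C²` solution of `W'' = (y²/4 + μ + iν(y)) W` with real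
`μ > −½` and real-valued `ν` vanishes identically (energy identity `∫ (|W'|² + (y²/4 + μ)|W|²) = 0`, the
boundary terms `re (W' W̄)` being disposed of along suitable sequences WITHOUT any a-priori decay of `W'`,
combined with the Hermite ground-state bound `∫ |W'|² + (y²/4)|W|² ≥ ½ ∫ |W|²`).  This part file is the
integrability half: under the hypotheses of the (forced) lemma, `|W|²`, `|W'|²` and `y²|W|²` are
integrable on `ℝ` (`weber_integrable`, registered sub-goal `resolventUnique_partA` in Pi-form), together
with the elementary tail / FTC / boundary-control lemmas it rests on.

The whole of parts A and B is TRANSPLANTED verbatim (renamed into this namespace) from §0 of the crux's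
standing-adversary file `Cruxes/BurgersLayerKH/Disproof.lean` (refuter-cdisprove, 2026-08-16; sorry-free,
not importable from `Theorems/`).  Pure proof file (no definitions).
-/

-- `Summit.<Summit>.<Problem>` is the tree's mandated summit-side namespace (CONVENTIONS §2); for this
-- single-conjunct summit the two coincide, so the duplicate is deliberate.
set_option linter.dupNamespace false

noncomputable section

open Filter Set MeasureTheory Topology intervalIntegral Complex

namespace Summit.AnomalousDissipation.AnomalousDissipation.Theorems.BurgersLayerKH.Sheet.ResolventUnique

-- §0 of Cruxes/BurgersLayerKH/Disproof.lean, first half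
-- adapted from Cruxes/BurgersLayerKH/Disproof.lean (refuter-cdisprove, 2026-08-16)

/-- An integrable function takes arbitrarily small absolute values beyond any threshold. [folklore] -/
theorem exists_ge_abs_le {g : ℝ → ℝ} (hg : Integrable g) {ε : ℝ} (hε : 0 < ε) (R : ℝ) :
    ∃ t, R ≤ t ∧ |g t| ≤ ε := by
  by_contra h
  push Not at h
  have hmono : IntegrableOn (fun _ : ℝ => ε) (Ici R) volume := by
    refine Integrable.mono' (hg.integrableOn (s := Ici R)).norm (by fun_prop) ?_
    refine ae_restrict_of_forall_mem measurableSet_Ici fun x hx => ?_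
    rw [Real.norm_eq_abs, abs_of_pos hε, Real.norm_eq_abs]
    exact (h x hx).le
  have := (integrableOn_const_iff (C := ε) (s := Ici R) (μ := volume)).1 hmono
  rcases this with h0 | hfin
  · exact hε.ne' (by simpa using h0)
  · simp [Real.volume_Ici] at hfin

/-- The same beyond any threshold towards `−∞`. [folklore] -/
theorem exists_le_abs_le {g : ℝ → ℝ} (hg : Integrable g) {ε : ℝ} (hε : 0 < ε) (R : ℝ) :
    ∃ s, s ≤ R ∧ |g s| ≤ ε := by
  obtain ⟨t, ht, hgt⟩ := exists_ge_abs_le (g := fun y => g (-y)) hg.comp_neg hε (-R)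
  exact ⟨-t, by linarith, by simpa using hgt⟩

/-- Uniform tails: the interval integrals of an integrable function over `[s, t]`, `s ≤ −R`, `t ≥ R`,
are `ε`-close to the full integral for `R` large. [folklore] -/
theorem tail_uniform {h : ℝ → ℝ} (hh : Integrable h) {ε : ℝ} (hε : 0 < ε) :
    ∃ R, ∀ s t, s ≤ -R → R ≤ t → |(∫ y in s..t, h y) - ∫ y, h y| ≤ ε := by
  have hT : Tendsto (fun p : ℝ × ℝ => ∫ y in p.1..p.2, h y) (atBot ×ˢ atTop) (𝓝 (∫ y, h y)) :=
    intervalIntegral_tendsto_integral hh tendsto_fst tendsto_snd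
  have hev := (Metric.tendsto_nhds.1 hT) ε hε
  obtain ⟨pa, hpa, pb, hpb, hboth⟩ := Filter.eventually_prod_iff.1 hev
  obtain ⟨R₁, hR₁⟩ := eventually_atBot.1 hpa
  obtain ⟨R₂, hR₂⟩ := eventually_atTop.1 hpb
  refine ⟨max (-R₁) R₂, fun s t hs ht => ?_⟩
  have h1 : pa s := hR₁ s (by linarith [le_max_left (-R₁) R₂])
  have h2 : pb t := hR₂ t (le_trans (le_max_right _ _) ht)
  have := hboth h1 h2
  rw [Real.dist_eq] at this
  exact this.le

/-- FTC for a `C¹`-type pair: `∫ₛᵗ f' = f t − f s` when `f'` is continuous. [folklore] -/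
theorem ftc {f f' : ℝ → ℝ} (hf : ∀ y, HasDerivAt f (f' y) y) (hc : Continuous f') (s t : ℝ) :
    ∫ y in s..t, f' y = f t - f s :=
  integral_eq_sub_of_hasDerivAt (fun y _ => hf y) (hc.intervalIntegrable _ _)

/-- Boundary control: if `0 ≤ n ≤ B` and `n' = 2F`, then `F` takes values `≤ ε` beyond every
threshold to the right and values `≥ −ε` beyond every threshold to the left (a bounded function
cannot have derivative bounded away from zero on a half-line). [folklore] -/
theorem boundary_control {n F : ℝ → ℝ} {B : ℝ} (hnd : ∀ y, HasDerivAt n (2 * F y) y)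
    (hn0 : ∀ y, 0 ≤ n y) (hBn : ∀ y, n y ≤ B) {ε : ℝ} (hε : 0 < ε) (R : ℝ) :
    (∃ t, R ≤ t ∧ F t ≤ ε) ∧ (∃ s, s ≤ R ∧ -ε ≤ F s) := by
  have hB0 : 0 ≤ B := (hn0 0).trans (hBn 0)
  have cn : Continuous n := continuous_iff_continuousAt.2 fun y => (hnd y).continuousAt
  constructor
  · by_contra hcon
    push Not at hcon
    set T := R + (B / (2 * ε) + 1) with hT
    have hpos : 0 < B / (2 * ε) + 1 := by positivity
    have hRT : R < T := by linarith
    obtain ⟨ξ, hξ, hslope⟩ :=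
      exists_hasDerivAt_eq_slope n (fun y => 2 * F y) hRT cn.continuousOn (fun y _ => hnd y)
    have hξF : ε < F ξ := hcon ξ hξ.1.le
    have hTR : 0 < T - R := by linarith
    have hnum : n T - n R = 2 * F ξ * (T - R) := by
      have hne : T - R ≠ 0 := hTR.ne'
      field_simp at hslope
      linarith [hslope]
    have h1 : n T - n R ≤ B := by linarith [hBn T, hn0 R]
    have h2 : 2 * ε * (T - R) < 2 * F ξ * (T - R) := by
      apply mul_lt_mul_of_pos_right _ hTR
      linarith
    have h3 : 2 * ε * (T - R) = B + 2 * ε := by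
      rw [hT]; field_simp; ring
    linarith
  · by_contra hcon
    push Not at hcon
    set S := R - (B / (2 * ε) + 1) with hS
    have hpos : 0 < B / (2 * ε) + 1 := by positivity
    have hSR : S < R := by linarith
    obtain ⟨ξ, hξ, hslope⟩ :=
      exists_hasDerivAt_eq_slope n (fun y => 2 * F y) hSR cn.continuousOn (fun y _ => hnd y)
    have hξF : F ξ < -ε := hcon ξ hξ.2.le
    have hRS : 0 < R - S := by linarith
    have hnum : n R - n S = 2 * F ξ * (R - S) := by
      have hne : R - S ≠ 0 := hRS.ne'
      field_simp at hslope
      linarith [hslope]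
    have h1 : -B ≤ n R - n S := by linarith [hBn S, hn0 R]
    have h2 : 2 * F ξ * (R - S) < 2 * (-ε) * (R - S) := by
      apply mul_lt_mul_of_pos_right _ hRS
      linarith
    have h3 : 2 * (-ε) * (R - S) = -(B + 2 * ε) := by
      rw [hS]; field_simp; ring
    linarith

/-- The bump `y ↦ max(c − y²/4, 0)` is continuous. [folklore] -/
theorem continuous_bump (c : ℝ) : Continuous fun y : ℝ => max (c - y ^ 2 / 4) 0 := by
  fun_prop

/-- The bump `y ↦ max(c − y²/4, 0)` has compact support (it vanishes for `|y| > 2√(max c 0)`).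
[folklore] -/
theorem hasCompactSupport_bump (c : ℝ) : HasCompactSupport fun y : ℝ => max (c - y ^ 2 / 4) 0 := by
  set Y : ℝ := 2 * Real.sqrt (max c 0) with hY
  have hY0 : 0 ≤ Y := by positivity
  have hzero : ∀ y : ℝ, Y < |y| → max (c - y ^ 2 / 4) 0 = 0 := by
    intro y hy
    have h1 : Y ^ 2 < y ^ 2 := by
      calc Y ^ 2 < |y| ^ 2 := by gcongr
        _ = y ^ 2 := sq_abs y
    have h2 : Y ^ 2 = 4 * max c 0 := by
      rw [hY, mul_pow, Real.sq_sqrt (le_max_right _ _)]; ring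
    have h3 : c ≤ max c 0 := le_max_left _ _
    exact max_eq_right (by nlinarith)
  refine HasCompactSupport.intro (isCompact_Icc : IsCompact (Icc (-Y) Y)) fun y hy => ?_
  apply hzero
  simp only [mem_Icc, not_and_or, not_le] at hy
  rcases hy with h | h
  · have : -y ≤ |y| := neg_le_abs y
    linarith
  · exact h.trans_le (le_abs_self y)

/-- Integrability bootstrap for the (forced) Weber energy lemma: under its hypotheses, `a² + b²`,
`a'² + b'²` and `y²(a² + b²)` are integrable on `ℝ`. [folklore] -/
theorem weber_integrable {a b a₁ b₁ a₂ b₂ r : ℝ → ℝ} {μ B : ℝ}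
    (ha : ∀ y, HasDerivAt a (a₁ y) y) (ha₁ : ∀ y, HasDerivAt a₁ (a₂ y) y)
    (hb : ∀ y, HasDerivAt b (b₁ y) y) (hb₁ : ∀ y, HasDerivAt b₁ (b₂ y) y)
    (hB : ∀ y, a y ^ 2 + b y ^ 2 ≤ B) (hrc : Continuous r) (hri : Integrable r)
    (heq : ∀ y, a₂ y * a y + b₂ y * b y = (y ^ 2 / 4 + μ) * (a y ^ 2 + b y ^ 2) + r y) :
    Integrable (fun y => a y ^ 2 + b y ^ 2) ∧ Integrable (fun y => a₁ y ^ 2 + b₁ y ^ 2) ∧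
      Integrable (fun y => y ^ 2 * (a y ^ 2 + b y ^ 2)) := by
  -- the players
  set n : ℝ → ℝ := fun y => a y ^ 2 + b y ^ 2 with hn_def
  set m : ℝ → ℝ := fun y => a₁ y ^ 2 + b₁ y ^ 2 with hm_def
  set F : ℝ → ℝ := fun y => a₁ y * a y + b₁ y * b y with hF_def
  set V : ℝ → ℝ := fun y => y ^ 2 / 4 + μ with hV_def
  have hBn : ∀ y, n y ≤ B := fun y => hB y
  have hn0 : ∀ y, 0 ≤ n y := fun y => by simp only [hn_def]; positivity
  have hm0 : ∀ y, 0 ≤ m y := fun y => by simp only [hm_def]; positivity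
  have hB0 : 0 ≤ B := (hn0 0).trans (hBn 0)
  -- continuity
  have ca : Continuous a := continuous_iff_continuousAt.2 fun y => (ha y).continuousAt
  have ca₁ : Continuous a₁ := continuous_iff_continuousAt.2 fun y => (ha₁ y).continuousAt
  have cb : Continuous b := continuous_iff_continuousAt.2 fun y => (hb y).continuousAt
  have cb₁ : Continuous b₁ := continuous_iff_continuousAt.2 fun y => (hb₁ y).continuousAt
  have cn : Continuous n := by simp only [hn_def]; fun_prop
  have cm : Continuous m := by simp only [hm_def]; fun_prop
  have cV : Continuous V := by simp only [hV_def]; fun_prop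
  -- derivatives of `n` and `F`
  have hnd : ∀ y, HasDerivAt n (2 * F y) y := by
    intro y
    have h := ((ha y).fun_mul (ha y)).fun_add ((hb y).fun_mul (hb y))
    have e : n = fun x => a x * a x + b x * b x := by funext x; simp only [hn_def]; ring
    rw [e]
    refine h.congr_deriv ?_
    simp only [hF_def]; ring
  have hFd : ∀ y, HasDerivAt F (m y + V y * n y + r y) y := by
    intro y
    have h := ((ha₁ y).fun_mul (ha y)).fun_add ((hb₁ y).fun_mul (hb y))
    rw [hF_def]
    refine h.congr_deriv ?_
    simp only [hm_def, hV_def, hn_def]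
    linear_combination heq y
  have iFTC : ∀ s t, ∫ y in s..t, (m y + V y * n y + r y) = F t - F s :=
    fun s t => ftc hFd (by fun_prop) s t
  -- `V = Vp - Vm`, `Vm` a compactly supported bump
  set Vp : ℝ → ℝ := fun y => max (V y) 0 with hVp_def
  set Vm : ℝ → ℝ := fun y => max (-μ - y ^ 2 / 4) 0 with hVm_def
  have hVp0 : ∀ y, 0 ≤ Vp y := fun y => le_max_right _ _
  have hVm0 : ∀ y, 0 ≤ Vm y := fun y => le_max_right _ _
  have hVpV : ∀ y, V y ≤ Vp y := fun y => le_max_left _ _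
  have hVsplit : ∀ y, V y = Vp y - Vm y := by
    intro y
    simp only [hVp_def, hVm_def, hV_def]
    rcases le_or_gt 0 (y ^ 2 / 4 + μ) with h | h
    · rw [max_eq_left h, max_eq_right (by linarith)]; ring
    · rw [max_eq_right h.le, max_eq_left (by linarith)]; ring
  have cVp : Continuous Vp := cV.max continuous_const
  have cVm : Continuous Vm := continuous_bump (-μ)
  have hVm_cs : HasCompactSupport Vm := hasCompactSupport_bump (-μ)
  have iVm : Integrable Vm := cVm.integrable_of_hasCompactSupport hVm_cs
  set P : ℝ → ℝ := fun y => m y + Vp y * n y with hP_def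
  have cP : Continuous P := by simp only [hP_def]; fun_prop
  have hP0 : ∀ y, 0 ≤ P y := fun y => by
    simp only [hP_def]; exact add_nonneg (hm0 y) (mul_nonneg (hVp0 y) (hn0 y))
  have hPle : ∀ y, P y ≤ (m y + V y * n y + r y) + (B * Vm y + |r y|) := by
    intro y
    simp only [hP_def]
    rw [hVsplit y]
    nlinarith [hVm0 y, hBn y, hn0 y, neg_abs_le (r y)]
  have iBVr : Integrable (fun y => B * Vm y + |r y|) := (iVm.const_mul B).add hri.abs
  set K : ℝ := 2 + ∫ y, (B * Vm y + |r y|) with hK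
  have hBVr0 : ∀ y, 0 ≤ B * Vm y + |r y| := fun y =>
    add_nonneg (mul_nonneg hB0 (hVm0 y)) (abs_nonneg _)
  have hbound : ∀ R, 0 ≤ R → ∫ y in (-R)..R, ‖P y‖ ≤ K := by
    intro R hR
    obtain ⟨⟨t, hRt, hFt⟩, -⟩ := boundary_control hnd hn0 hBn one_pos R
    obtain ⟨-, ⟨s, hsR, hFs⟩⟩ := boundary_control hnd hn0 hBn one_pos (-R)
    have hst : s ≤ t := by linarith
    have e1 : ∫ y in (-R)..R, ‖P y‖ = ∫ y in (-R)..R, P y :=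
      integral_congr fun y _ => Real.norm_of_nonneg (hP0 y)
    rw [e1]
    have h1 : ∫ y in (-R)..R, P y ≤ ∫ y in s..t, P y := by
      apply integral_mono_interval hsR (by linarith) hRt
      · exact Eventually.of_forall fun y => hP0 y
      · exact cP.intervalIntegrable _ _
    have h2 : ∫ y in s..t, P y ≤ ∫ y in s..t, ((m y + V y * n y + r y) + (B * Vm y + |r y|)) :=
      integral_mono_on hst (cP.intervalIntegrable _ _)
        ((by fun_prop : Continuous fun y => (m y + V y * n y + r y) + (B * Vm y + |r y|)).intervalIntegrable _ _)
        fun y _ => hPle y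
    have h3 : ∫ y in s..t, ((m y + V y * n y + r y) + (B * Vm y + |r y|))
        = (F t - F s) + ∫ y in s..t, (B * Vm y + |r y|) := by
      rw [integral_add ((by fun_prop : Continuous fun y => m y + V y * n y + r y).intervalIntegrable _ _)
        ((by fun_prop : Continuous fun y => B * Vm y + |r y|).intervalIntegrable _ _), iFTC]
    have h4 : ∫ y in s..t, (B * Vm y + |r y|) ≤ ∫ y, (B * Vm y + |r y|) := by
      rw [integral_of_le hst]
      exact setIntegral_le_integral iBVr (Eventually.of_forall hBVr0)
    linarith only [h1, h2, h3, h4, hFt, hFs, hK]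
  have iP : Integrable P := by
    refine integrable_of_intervalIntegral_norm_bounded K (a := fun R : ℝ => -R) (b := id) (l := atTop)
      (fun R => (cP.integrableOn_Icc).mono_set Ioc_subset_Icc_self) tendsto_neg_atTop_atBot tendsto_id ?_
    filter_upwards [eventually_ge_atTop 0] with R hR using hbound R hR
  have im : Integrable m := iP.mono' cm.aestronglyMeasurable (Eventually.of_forall fun y => by
    rw [Real.norm_of_nonneg (hm0 y)]; simp only [hP_def]
    exact le_add_of_nonneg_right (mul_nonneg (hVp0 y) (hn0 y)))
  have iVpn : Integrable (fun y => Vp y * n y) :=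
    iP.mono' (cVp.mul cn).aestronglyMeasurable (Eventually.of_forall fun y => by
      rw [Real.norm_of_nonneg (mul_nonneg (hVp0 y) (hn0 y))]; simp only [hP_def]
      exact le_add_of_nonneg_left (hm0 y))
  have iVmn : Integrable (fun y => Vm y * n y) :=
    (cVm.mul cn).integrable_of_hasCompactSupport hVm_cs.mul_right
  have iVn : Integrable (fun y => V y * n y) := by
    refine (iVpn.sub iVmn).congr (Eventually.of_forall fun y => ?_)
    simp only [Pi.sub_apply]
    rw [hVsplit y]; ring
  -- a compactly supported continuous `ρ ≥ 1 - V`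
  set ρ : ℝ → ℝ := fun y => max ((1 - μ) - y ^ 2 / 4) 0 with hρ_def
  have cρ : Continuous ρ := continuous_bump (1 - μ)
  have hρ_cs : HasCompactSupport ρ := hasCompactSupport_bump (1 - μ)
  have iρn : Integrable (fun y => ρ y * n y) :=
    (cρ.mul cn).integrable_of_hasCompactSupport hρ_cs.mul_right
  have inn : Integrable n := by
    refine (iVpn.add iρn).mono' cn.aestronglyMeasurable (Eventually.of_forall fun y => ?_)
    rw [Real.norm_of_nonneg (hn0 y)]
    simp only [Pi.add_apply]
    have h1 : 1 ≤ Vp y + ρ y := by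
      have e1 := hVpV y
      have e2 : (1 - μ) - y ^ 2 / 4 ≤ ρ y := le_max_left _ _
      simp only [hV_def] at e1
      linarith
    nlinarith [hn0 y]
  have iy2n : Integrable (fun y => y ^ 2 * n y) := by
    refine ((iVn.sub (inn.const_mul μ)).const_mul 4).congr (Eventually.of_forall fun y => ?_)
    simp only [Pi.sub_apply, hV_def]; ring
  exact ⟨inn, im, iy2n⟩

/-- **Registered sub-goal `resolventUnique_partA`** (part file A of `stub_resolventUnique`): the integrability
bootstrap `weber_integrable` in Pi-form. [folklore] -/
theorem resolventUnique_partA : ∀ (a b a₁ b₁ a₂ b₂ r : ℝ → ℝ) (μ B : ℝ), (∀ y, HasDerivAt a (a₁ y) y) → (∀ y, HasDerivAt a₁ (a₂ y) y) → (∀ y, HasDerivAt b (b₁ y) y) → (∀ y, HasDerivAt b₁ (b₂ y) y) → (∀ y, a y ^ 2 + b y ^ 2 ≤ B) → Continuous r → MeasureTheory.Integrable r → (∀ y, a₂ y * a y + b₂ y * b y = (y ^ 2 / 4 + μ) * (a y ^ 2 + b y ^ 2) + r y) → MeasureTheory.Integrable (fun y => a y ^ 2 + b y ^ 2) ∧ MeasureTheory.Integrable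 (fun y => a₁ y ^ 2 + b₁ y ^ 2) ∧ MeasureTheory.Integrable (fun y => y ^ 2 * (a y ^ 2 + b y ^ 2)) :=
  fun _ _ _ _ _ _ _ _ _ ha ha₁ hb hb₁ hB hrc hri heq => weber_integrable ha ha₁ hb hb₁ hB hrc hri heq

end Summit.AnomalousDissipation.AnomalousDissipation.Theorems.BurgersLayerKH.Sheet.ResolventUnique

end
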